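import Summits.BirchSwinnertonDyer.Rank1Residual.X5.SelfDualRelaxedStrictCount
import HarnessLib

/-!
# Transversality in dual form: `𝓚_{v₀} ∩ w⁻¹(C^*) = 0` when the condition `C` and the Kummer line
# `𝓚_{v₀}` SPAN `H¹(K_{v₀}, E[n])` — input (iv) of the finite-level count (C) (cell `b2b-bsdres`,
# CLASS-CLOSURE lane, class O10 — x1b GEN 37, class lead; file 65 of the series)

HONEST FRAMING (cell `b2b-bsdres`, run/shared/lean/b2b/bsd-rank1-residual/, verbatim in every
file): the goal of the cell is to DELETE the COMBINATION-SHAPED residual classes of the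
Birch–Swinnerton-Dyer formula for ALL analytic-rank `≤ 1` elliptic curves over `ℚ` — "full BSD
formula for every rank `≤ 1` curve in class `C`" assembled STRICTLY from published theorems — so
that the rank-`≤ 1` remainder becomes exactly the CONSTRUCTION-SHAPED classes, which are TYPED
(missing-input `Prop`s), NOT attempted. This is not "finishing BSD". CLASS-CLOSURE lane: prove
what is provable now; shrink each hard class to its core with data; no claim beyond stated classes;
research routes on CONSTRUCTION-SHAPED X12 / O10; census / instrument output = EVIDENCE / conjecture
items, NEVER a Literature fact; `RESIDUAL-MAP.md` marks change only by signed lines. THIS FILE: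
TOOL THEOREMS ONLY — no definition, no named Literature fact, no Summits-side fact `def … : Prop`,
no `sorry`, axioms standard; CONDITIONAL (hypotheses) on local Tate duality at the finite place
(`IsPerfect` of a family `inv`, the property list of the tree's named fact
`poitouTate_selmerStructure_duality`) and on the residual self-duality of the Kummer condition at
`v₀` (`hsd`); nothing is booked; no label / mark / count / sub-cell moves; (C1_η), (C2_η-GZ), (C3_η)
stay typed as filed (cc-typer-6's pen); O10 stays OPEN / CONSTRUCTION-SHAPED; nothing about
`BSD(W, p)` of any pair is claimed.

## What (x1b GEN 37 file 63 `DefectCountFiniteLevel`, input (iv))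

File 63 needs `𝓚_{v₀} ⊓ w⁻¹(C^*) = ⊥`: the Kummer line at `v₀ = (p)` meets the Weil transport of the
annihilator of the signed condition `C = C_m` trivially.  In (C) this is TRANSVERSALITY (T) (x1b
GEN 31–34: `C_m ∩ L_m = 0`) plus B3 (`#C_m = p^m`) plus Tate's local Euler characteristic
(`#H¹(ℚ_p, W[p^m]) = p^{2m} = #C_m · #L_m`), which together say `C_m ⊕ L_m = H¹(ℚ_p, W[p^m])`:

* `dualLocalCondition_sup` — `(A ⊔ B)^* = A^* ⊓ B^*`;
* `sup_eq_top_of_inf_eq_bot_of_card_mul_eq` — in a finite abelian group, `C ⊓ L = ⊥` and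
  `#C · #L = #H` force `C ⊔ L = ⊤`;
* **`kummer_inf_comap_dualLocalCondition_eq_bot`** — at a finite place `v₀` with `inv_{v₀}` perfect and
  `w⁻¹(𝓚_{v₀}^*) = 𝓚_{v₀}`: **`C ⊔ 𝓚_{v₀} = ⊤ ⟹ 𝓚_{v₀} ⊓ w⁻¹(C^*) = ⊥`** (an element of `𝓚_{v₀}` whose
  transport annihilates `C` annihilates `C ⊔ 𝓚_{v₀} = ⊤`, hence is `0` by local Tate duality and the
  injectivity of `H¹(w_{v₀})`); `…_of_card` — the same from `C ⊓ 𝓚_{v₀} = ⊥`, `#C · #𝓚_{v₀} = #H¹`.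

References: [Howard2004HeegnerKolyvagin] Def. 2.1.6; [MilneADT2006] I Cor. 2.3, Lemma 6.15;
[Kobayashi2003] Thm. 6.2, Prop. 8.12; [Sakamoto2024] §3.1.2.
-/

noncomputable section

open scoped Classical

universe u

open CategoryTheory Field Function NumberField IsDedekindDomain WeierstrassCurve
open Literature.NumberTheory.EllipticCurves
open Literature.NumberTheory.GaloisRepresentations
open Literature.NumberTheory.GaloisRepresentations.DiscreteGaloisModule (mu MuCarrier SelmerStructure
  localTatePairingZMod tateDual localMap)
open Literature.NumberTheory.GaloisCohomology
open Summit.BirchSwinnertonDyer.Rank1Residual.X11b.LocBridge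
open scoped ContRepresentation

namespace Summit.BirchSwinnertonDyer.Rank1Residual.Additive.KummerLineTransverseDual

/-! ## §1. Two generic lemmas -/

section Generic

variable {K : Type u} [Field K] [NumberField K] {n : ℕ} {M : Type u} [AddCommGroup M]
  [TopologicalSpace M] [DiscreteTopology M] [Finite M] (inv : LocalInvariants K n)
  (ρ : DiscreteGaloisModule K M)

/-- **`(A ⊔ B)^* = A^* ⊓ B^*`**: the annihilator of a sum of local conditions is the intersection of
the annihilators. [cite: Howard2004HeegnerKolyvagin, Def. 2.1.6 (arXiv:1202.6340 p. 5)] -/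
theorem dualLocalCondition_sup (v : Place K) (A B : AddSubgroup (galoisCohomology (ρ.toLocal v) 1)) :
    inv.dualLocalCondition ρ v (A ⊔ B) = inv.dualLocalCondition ρ v A ⊓ inv.dualLocalCondition ρ v B := by
  refine le_antisymm (le_inf (inv.dualLocalCondition_anti ρ v le_sup_left)
    (inv.dualLocalCondition_anti ρ v le_sup_right)) ?_
  rintro y ⟨hA, hB⟩ a ha
  obtain ⟨a₁, ha₁, a₂, ha₂, rfl⟩ := AddSubgroup.mem_sup.mp ha
  rw [map_add, AddMonoidHom.add_apply, hA a₁ ha₁, hB a₂ ha₂, add_zero]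

/-- **`C ⊓ L = ⊥` and `#C · #L = #H` force `C ⊔ L = ⊤`** in a finite abelian group
(`#(C ⊔ L) = #L · [C ⊔ L : L] = #L · [C : C ⊓ L] = #L · #C`).  In (C): `C = C_m`, `L = L_m` the Kummer
line, `H = H¹(ℚ_p, W[p^m])` of order `p^{2m}` (Tate), `#C_m = #L_m = p^m` (B3, `E(ℚ_p)[p] = 0`),
`C_m ∩ L_m = 0` (transversality). [folklore] -/
theorem sup_eq_top_of_inf_eq_bot_of_card_mul_eq {H : Type*} [AddCommGroup H] [Finite H]
    (C L : AddSubgroup H) (hCL : C ⊓ L = ⊥) (hcard : Nat.card C * Nat.card L = Nat.card H) :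
    C ⊔ L = ⊤ := by
  have h1 : L.relIndex (C ⊔ L) = Nat.card C := by
    rw [AddSubgroup.relIndex_sup_right, ← AddSubgroup.inf_relIndex_right, inf_comm, hCL,
      AddSubgroup.relIndex_bot_left]
  have h2 : Nat.card (L.addSubgroupOf (C ⊔ L)) = Nat.card L :=
    Nat.card_congr (AddSubgroup.addSubgroupOfEquivOfLe (le_sup_right : L ≤ C ⊔ L)).toEquiv
  have h3 : Nat.card (L.addSubgroupOf (C ⊔ L)) * (L.addSubgroupOf (C ⊔ L)).index =
      Nat.card (C ⊔ L : AddSubgroup H) := AddSubgroup.card_mul_index _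
  rw [h2] at h3
  have h4 : (L.addSubgroupOf (C ⊔ L)).index = L.relIndex (C ⊔ L) := rfl
  rw [h4, h1, mul_comm, hcard] at h3
  exact AddSubgroup.eq_top_of_card_eq _ h3.symm

end Generic

/-! ## §2. The Kummer line is transverse to the transported annihilator of a spanning complement -/

section Kummer

variable {K : Type u} [Field K] [NumberField K] (W : WeierstrassCurve K) (n : ℕ) [NeZero n]
  [W.IsElliptic] [Finite (geomTorsion W n)]
variable (e : geomTorsion W n → geomTorsion W n → AlgebraicClosure K)
  (hμ : ∀ S T, e S T ^ n = 1)
  (hadd₁ : ∀ S₁ S₂ T, e (S₁ + S₂) T = e S₁ T * e S₂ T)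
  (hadd₂ : ∀ S T₁ T₂, e S (T₁ + T₂) = e S T₁ * e S T₂)
  (hgal : ∀ (σ : absoluteGaloisGroup K) (S T : geomTorsion W n), σ • e S T = e (σ • S) (σ • T))
  (hnondeg : ∀ T, (∀ S, e S T = 1) → T = 0)
  (inv : LocalInvariants K n)

include hnondeg in
/-- **`C ⊔ 𝓚_{v₀} = ⊤ ⟹ 𝓚_{v₀} ⊓ w⁻¹(C^*) = ⊥`** at a finite place `v₀ = w₀` where `inv_{v₀}` is a
local Tate duality (`IsPerfect`: `(⊤)^* = ⊥`, X11b `dualLocalCondition_top`) and the Kummer condition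
is residually self-dual (`w⁻¹(𝓚_{v₀}^*) = 𝓚_{v₀}`, `hsd`): an `x ∈ 𝓚_{v₀}` with `w x ∈ C^*` has
`w x ∈ 𝓚_{v₀}^* ⊓ C^* = (C ⊔ 𝓚_{v₀})^* = ⊤^* = 0`, and `H¹(w_{v₀})` is injective.  Input (iv) of file
63 `DefectCountFiniteLevel.relIndex_mul_prime_pow_eq_card_mul_prod`.
[cite: MilneADT2006, Ch. I, Cor. 2.3 and Lemma 6.15] [cite: Sakamoto2024, §3.1.2 (p. 924)] -/
theorem kummer_inf_comap_dualLocalCondition_eq_bot (hperf : inv.IsPerfect) (w₀ : HeightOneSpectrum (𝓞 K))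
    (hsd : inv.dualTransported (W.kummerSelmerStructure (n : ℤ) :
        SelmerStructure (W.torsionGaloisModule n))
      (weilDualIntertwining W n e hμ hadd₁ hadd₂ hgal) (Sum.inr w₀) =
        W.kummerSelmerStructure (n : ℤ) (Sum.inr w₀))
    (C : AddSubgroup (galoisCohomology ((W.torsionGaloisModule n).toLocal (Sum.inr w₀)) 1))
    (hCL : C ⊔ W.kummerSelmerStructure (n : ℤ) (Sum.inr w₀) = ⊤) :
    W.kummerSelmerStructure (n : ℤ) (Sum.inr w₀) ⊓
        (inv.dualLocalCondition (W.torsionGaloisModule n) (Sum.inr w₀) C).comap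
          (localMap (weilDualIntertwining W n e hμ hadd₁ hadd₂ hgal) (Sum.inr w₀)) = ⊥ := by
  have hM : ∀ T : geomTorsion W n, n • T = 0 := fun T => AddSubgroup.torsionBy.nsmul T
  rw [eq_bot_iff]
  intro x hx
  obtain ⟨hxL, hxC⟩ := AddSubgroup.mem_inf.mp hx
  rw [AddSubgroup.mem_bot]
  rw [AddSubgroup.mem_comap] at hxC
  -- `w x ∈ 𝓚^*` by residual self-duality
  have hxL' : localMap (weilDualIntertwining W n e hμ hadd₁ hadd₂ hgal) (Sum.inr w₀) x ∈
      inv.dualLocalCondition (W.torsionGaloisModule n) (Sum.inr w₀)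
        (W.kummerSelmerStructure (n : ℤ) (Sum.inr w₀)) := by
    rw [← hsd, LocalInvariants.mem_dualTransported_iff, LocalInvariants.dualSelmerStructure_apply] at hxL
    exact hxL
  -- hence `w x ∈ (C ⊔ 𝓚)^* = ⊤^* = ⊥`
  have h0 : localMap (weilDualIntertwining W n e hμ hadd₁ hadd₂ hgal) (Sum.inr w₀) x = 0 := by
    have hmem : localMap (weilDualIntertwining W n e hμ hadd₁ hadd₂ hgal) (Sum.inr w₀) x ∈
        inv.dualLocalCondition (W.torsionGaloisModule n) (Sum.inr w₀)
          (C ⊔ W.kummerSelmerStructure (n : ℤ) (Sum.inr w₀)) := by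
      rw [dualLocalCondition_sup]; exact ⟨hxC, hxL'⟩
    rw [hCL, X11b.PoitouTateCounting.dualLocalCondition_top hperf (W.torsionGaloisModule n) hM w₀,
      AddSubgroup.mem_bot] at hmem
    exact hmem
  exact map_weilDual_restrictField_injective W n e hμ hadd₁ hadd₂ hgal hnondeg
    (Place.Completion (Sum.inr w₀ : Place K)) (h0.trans (map_zero _).symm)

include hnondeg in
/-- **The same from transversality and counting**: `C ⊓ 𝓚_{v₀} = ⊥` and `#C · #𝓚_{v₀} = #H¹(K_{v₀}, E[n])`
⟹ `𝓚_{v₀} ⊓ w⁻¹(C^*) = ⊥`.  In (C): `#C_m = p^m` (B3), `#𝓚_{v₀} = #E(ℚ_p)[p^m] · #(ℤ_p/p^m) = p^m`,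
`#H¹(ℚ_p, W[p^m]) = p^{2m}` (Tate's local Euler characteristic), `C_m ∩ L_m = 0` (x1b GEN 31–34).
[cite: MilneADT2006, Ch. I, Cor. 2.3, Thm. 2.8 and Lemma 3.3] [cite: Kobayashi2003, Thm. 6.2 (p. 11) and Prop. 8.12 (p. 17)] -/
theorem kummer_inf_comap_dualLocalCondition_eq_bot_of_card (hperf : inv.IsPerfect)
    (w₀ : HeightOneSpectrum (𝓞 K))
    [Finite (galoisCohomology ((W.torsionGaloisModule n).toLocal (Sum.inr w₀)) 1)]
    (hsd : inv.dualTransported (W.kummerSelmerStructure (n : ℤ) :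
        SelmerStructure (W.torsionGaloisModule n))
      (weilDualIntertwining W n e hμ hadd₁ hadd₂ hgal) (Sum.inr w₀) =
        W.kummerSelmerStructure (n : ℤ) (Sum.inr w₀))
    (C : AddSubgroup (galoisCohomology ((W.torsionGaloisModule n).toLocal (Sum.inr w₀)) 1))
    (hCL : C ⊓ W.kummerSelmerStructure (n : ℤ) (Sum.inr w₀) = ⊥)
    (hcard : Nat.card C * Nat.card (W.kummerSelmerStructure (n : ℤ) (Sum.inr w₀)) =
      Nat.card (galoisCohomology ((W.torsionGaloisModule n).toLocal (Sum.inr w₀)) 1)) :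
    W.kummerSelmerStructure (n : ℤ) (Sum.inr w₀) ⊓
        (inv.dualLocalCondition (W.torsionGaloisModule n) (Sum.inr w₀) C).comap
          (localMap (weilDualIntertwining W n e hμ hadd₁ hadd₂ hgal) (Sum.inr w₀)) = ⊥ :=
  kummer_inf_comap_dualLocalCondition_eq_bot W n e hμ hadd₁ hadd₂ hgal hnondeg inv hperf w₀ hsd C
    (sup_eq_top_of_inf_eq_bot_of_card_mul_eq C _ hCL hcard)

end Kummer

end Summit.BirchSwinnertonDyer.Rank1Residual.Additive.KummerLineTransverseDual

end
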